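import Literature.Probability.RandomPlanarGeometry.SLETransienceLocal
import Literature.Probability.RandomPlanarGeometry.SLERestrictionSimple
import Literature.Probability.RandomPlanarGeometry.SLERestrictionHitReduction
import Literature.Probability.RandomPlanarGeometry.SLERestrictionHitStolz
import Literature.Probability.RandomPlanarGeometry.HullRestrictionSLE
import Literature.Probability.RandomPlanarGeometry.SLEUniquenessInLaw
import Literature.Probability.RandomPlanarGeometry.CritPercSLESimplePathProofs
import HarnessLib

/-!
# [LSW] Theorem 6.1 for SLE_{8/3} and its transposition, from `HasSLETrace (8/3)` and Prop. 5.2/5.3 only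

Proof-only re-threading (no new named fact). G. F. Lawler, O. Schramm, W. Werner, *Conformal
restriction: the chordal case*, J. Amer. Math. Soc. **16** (2003) 917–955 (**[LSW]**), Thm. 6.1:
"chordal SLE_{8/3} satisfies `P[γ[0, ∞) ∩ A = ∅] = Φ'_A(0)^{5/8}` for all `A ∈ 𝒬*`", and its
transposition to Dobrushin domains `IsSLELaw.hullRestriction_eightThirds`.

The proofs of these statements in the tree (`SLERestrictionSimple`, `HullRestrictionNull`,
`SLELawTransport`, `HullRestrictionSLE`) consume the transience of the SLE trace through the
named fact `tendsto_norm_sleTrace_atTop` — Rohde–Schramm's Thm. 7.1 for EVERY `κ > 0`, which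
at `κ = 8` rests on the SLE₈ trace theorem of Lawler–Schramm–Werner (2004) — although only its
instance at `κ = 8/3` is ever used. Since `SLETransienceLocal` that instance is a THEOREM given
`HasSLETrace (8/3)` (`tendsto_norm_sleTrace_atTop_eightThirds_of_hasSLETrace`), as are, by now,
every other input of the printed proof except two. This file repeats the consumers with the
transience hypothesis read at `κ = 8/3` and every proved input supplied by its proof (bodies
otherwise verbatim; names suffixed `_of_hasSLETrace`):

* `sle_restriction_eightThirds_of_hasSLETrace` — **[LSW] Thm. 6.1 from TWO named facts**:
  `HasSLETrace (8/3)` (Rohde–Schramm (2005), Thm. 5.1 at `κ = 8/3`) and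
  `sle_exists_isRestrictionMartingale` ([LSW] Prop. 5.2/5.3, the restriction martingale
  `h_t'(W_t)^{5/8}`). Discharged on the way: simplicity of the trace (RS05 Thm. 6.1,
  `ae_isSimpleTrace_sleTrace_of_hasSLETrace`), transience (RS05 Thm. 7.1,
  `tendsto_norm_sleTrace_atTop_eightThirds_of_hasSLETrace`), swallowing = hitting
  (`sle_swallowingTime_ofReal_eq_firstHit_holds`), measurability of the trace
  (`aemeasurable_sleTrace_holds`), [LSW] Lemma 6.2 (`restrictionDeriv_exitTime_gt_simple_holds`),
  Lemma 6.3 (`restrictionDerivVanishesAtHit_of_stolz` with `IsSmoothHull.hitPath_stolz_holds`),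
  Lemma 2.1 (`IsPlusHull.exists_antitone_isSmoothHull_holds`), `Φ_A` and `Φ'_A(0)`
  (`IsStarHull.existsUnique_isRestrictionMap_holds`, `IsStarHull.exists_hasRestrictionDeriv_holds`);
* `exists_isSLECurve_through_of_ae_tendsto` — the SLE_κ curve through a prescribed uniformizing
  map (`exists_isSLECurve_through`, `SLELawTransport`) with transience assumed at `κ` only;
* `measure_subset_closure_le_measure_avoid_of_hasSLETrace` — touching the pulled-back hull
  without entering it is null (`HullRestrictionNull`), from Thm. 6.1 and `HasSLETrace (8/3)`;
* `IsSLELaw.hullRestriction_eightThirds_of_sle_restriction` — the transposition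
  (`IsSLELaw.hullRestriction_eightThirds_of_facts_at`, `HullRestrictionSLE`) from Thm. 6.1 in the
  half-plane and `HasSLETrace (8/3)`, the classical inputs (Jordan curve and arc theorems,
  Riemann mapping, Carathéodory, simple connectivity, uniqueness in law of chordal SLE
  `IsSLECurve.map_eq_holds`, [LSW] Lemma 3.5 `HasRestrictionDeriv.tendsto_of_kernel_holds`) being
  theorems of the tree;
* `IsSLELaw.hullRestriction_eightThirds_of_hasSLETrace` — hence the transposed Thm. 6.1 from
  `HasSLETrace (8/3)` and `sle_exists_isRestrictionMartingale` alone.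

## References

* G. F. Lawler, O. Schramm, W. Werner, *Conformal restriction: the chordal case*, J. Amer. Math.
  Soc. **16** (2003), arXiv:math/0209343: Thm. 6.1 (p. 23) and its proof (§6), Lemmas 6.2, 6.3,
  Prop. 5.2/5.3, Prop. 3.3 and Lemma 3.5. [LawlerSchrammWerner2003Restriction]
* S. Rohde, O. Schramm, *Basic properties of SLE*, Ann. of Math. 161 (2005), Thms. 5.1, 6.1, 7.1.
* G. F. Lawler, *Conformally Invariant Processes in the Plane*, AMS (2005), §6.3 (chordal SLE in
  a domain).
-/

noncomputable section

open Set Filter Topology Metric MeasureTheory Complex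
open UpperHalfPlane (upperHalfPlaneSet isOpen_upperHalfPlaneSet)
open scoped NNReal ENNReal

namespace Literature.Probability.RandomPlanarGeometry

/-! ### [LSW] Lemma 6.2 for SLE_{8/3} and one-sided hulls, from `HasSLETrace (8/3)` -/

section SLE

variable {A : Set ℂ}

/-- **[LSW] Lemma 6.2 for SLE_{8/3} and `A ∈ 𝒬₊`, from `HasSLETrace (8/3)` alone** — as
`sle_restrictionDeriv_frequently_gt_of_isPlusHull'` (`SLERestrictionSimple`), with the simplicity
(`ae_isSimpleTrace_sleTrace_of_hasSLETrace`, Rohde–Schramm Thm. 6.1), the transience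
(`tendsto_norm_sleTrace_atTop_eightThirds_of_hasSLETrace`, Thm. 7.1) and the swallowing
identification (`sle_swallowingTime_ofReal_eq_firstHit_holds`) of the SLE_{8/3} trace supplied by
their proofs. [cite: LawlerSchrammWerner2003Restriction, Lemma 6.2 and proof of Thm. 6.1 (§6)] -/
theorem sle_restrictionDeriv_frequently_gt_of_isPlusHull_of_hasSLETrace
    (hgen : HasSLETrace ((8 : ℝ≥0) / 3)) (hA : IsPlusHull A) :
    sle_restrictionDeriv_frequently_gt A := by
  have h₆ : RandomPlanarGeometry.ae_isSimpleTrace_sleTrace_of_le_four (κ := (8 : ℝ≥0) / 3) :=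
    fun _ h4 ↦ ae_isSimpleTrace_sleTrace_of_hasSLETrace hgen h4
  have htr := tendsto_norm_sleTrace_atTop_eightThirds_of_hasSLETrace hgen
  have hswallow : sle_swallowingTime_ofReal_eq_firstHit := sle_swallowingTime_ofReal_eq_firstHit_holds
  have hκ0 : (0 : ℝ≥0) < 8 / 3 := by positivity
  have hκ4 : (8 : ℝ≥0) / 3 ≤ 4 := by
    rw [div_le_iff₀ (by norm_num : (0 : ℝ≥0) < 3)]
    norm_num
  filter_upwards [ae_isGeneratedByCurve_sleTrace hgen, h₆ hκ0 hκ4, htr] with ω hgenω hsω htrω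
    hT ε hε
  have hdisj : ∀ t, Disjoint (Loewner.closedHull (sleDriving ((8 : ℝ≥0) / 3) ω) t) A :=
    disjoint_closedHull hswallow hgenω hsω (firstHit_eq_top_iff_disjoint.1 hT)
  obtain ⟨r₀, hr₀⟩ := Loewner.restrictionDeriv_exitTime_gt_simple_holds (continuous_sleDriving _ ω)
    (sleDriving_zero _ ω) hgenω hsω hA hdisj ε hε
  rw [frequently_atTop]
  intro a
  obtain ⟨r, hr, t, hat, ht⟩ := exists_isExitTime_ge hswallow hgenω hsω htrω a r₀
  exact ⟨t, hat, hr₀ r hr t ht⟩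


/-- **[LSW] Lemma 6.2 for SLE_{8/3} and `A ∈ 𝒬₋`, from `HasSLETrace (8/3)` alone** — as
`sle_restrictionDeriv_frequently_gt_of_isMinusHull'` (`SLERestrictionSimple`), with simplicity,
transience and the swallowing identification of the SLE_{8/3} trace supplied by their proofs.
[cite: LawlerSchrammWerner2003Restriction, Lemma 6.2 and proof of Thm. 6.1 (§6)] -/
theorem sle_restrictionDeriv_frequently_gt_of_isMinusHull_of_hasSLETrace
    (hgen : HasSLETrace ((8 : ℝ≥0) / 3)) (hA : IsMinusHull A) :
    sle_restrictionDeriv_frequently_gt A := by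
  have h₆ : RandomPlanarGeometry.ae_isSimpleTrace_sleTrace_of_le_four (κ := (8 : ℝ≥0) / 3) :=
    fun _ h4 ↦ ae_isSimpleTrace_sleTrace_of_hasSLETrace hgen h4
  have htr := tendsto_norm_sleTrace_atTop_eightThirds_of_hasSLETrace hgen
  have hswallow : sle_swallowingTime_ofReal_eq_firstHit := sle_swallowingTime_ofReal_eq_firstHit_holds
  have hκ0 : (0 : ℝ≥0) < 8 / 3 := by positivity
  have hκ4 : (8 : ℝ≥0) / 3 ≤ 4 := by
    rw [div_le_iff₀ (by norm_num : (0 : ℝ≥0) < 3)]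
    norm_num
  filter_upwards [ae_isGeneratedByCurve_sleTrace hgen, h₆ hκ0 hκ4, htr] with ω hgenω hsω htrω
    hT ε hε
  have hdisj : ∀ t, Disjoint (Loewner.closedHull (sleDriving ((8 : ℝ≥0) / 3) ω) t) A :=
    disjoint_closedHull hswallow hgenω hsω (firstHit_eq_top_iff_disjoint.1 hT)
  obtain ⟨r₀, hr₀⟩ := Loewner.restrictionDeriv_exitTime_gt_of_isMinusHull_simple
    (continuous_sleDriving _ ω) (sleDriving_zero _ ω) hgenω hsω hA hdisj hε
  rw [frequently_atTop]
  intro a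
  obtain ⟨r, hr, t, hat, ht⟩ := exists_isExitTime_ge hswallow hgenω hsω htrω a r₀
  exact ⟨t, hat, hr₀ r hr t ht⟩

/-- **[LSW] Lemma 6.2 for SLE_{8/3} and `A ∈ 𝒬₊ ∪ 𝒬₋`, from `HasSLETrace (8/3)` alone.**
[cite: LawlerSchrammWerner2003Restriction, Lemma 6.2 and proof of Thm. 6.1 (§6)] -/
theorem sle_restrictionDeriv_frequently_gt_of_isPlusHull_or_isMinusHull_of_hasSLETrace
    (hgen : HasSLETrace ((8 : ℝ≥0) / 3)) (hA : IsPlusHull A ∨ IsMinusHull A) :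
    sle_restrictionDeriv_frequently_gt A :=
  hA.elim (sle_restrictionDeriv_frequently_gt_of_isPlusHull_of_hasSLETrace hgen)
    (sle_restrictionDeriv_frequently_gt_of_isMinusHull_of_hasSLETrace hgen)

end SLE

/-! ### [LSW] Thm. 6.1 for smooth and one-sided hulls -/

section Smooth

variable {A : Set ℂ}

/-- **[LSW] Thm. 6.1 for a smooth hull `A ∈ 𝒬₊ ∪ 𝒬₋`, from `HasSLETrace (8/3)` and
Prop. 5.2/5.3** — as `sle_measure_disjoint_eq_of_isSmoothHull'` (`SLERestrictionSimple`), with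
[LSW] Lemma 6.3 now the theorem `restrictionDerivVanishesAtHit_of_stolz hitPath_stolz_holds`
(`SLERestrictionHitReduction`, `SLERestrictionHitStolz`) and `Φ_A` unique
(`IsStarHull.existsUnique_isRestrictionMap_holds`).
[cite: LawlerSchrammWerner2003Restriction, Thm. 6.1 and its proof (§6), smooth one-sided case] -/
theorem sle_measure_disjoint_eq_of_isSmoothHull_of_hasSLETrace (hgen : HasSLETrace ((8 : ℝ≥0) / 3))
    (hM : sle_exists_isRestrictionMartingale) (hA : IsSmoothHull A) (hA' : IsPlusHull A ∨ IsMinusHull A)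
    {Φ : ConformalEquiv (upperHalfPlaneSet \ A) upperHalfPlaneSet} (hΦ : IsRestrictionMap A Φ)
    {d : ℝ} (hd : HasRestrictionDeriv A Φ d) :
    Process.preWienerMeasure {ω | Disjoint (range (sleTrace ((8 : ℝ≥0) / 3) ω)) A} =
      ENNReal.ofReal (d ^ ((5 : ℝ) / 8)) := by
  haveI : Fact Process.isProjectiveLimit_preWienerMeasure := ⟨isProjectiveLimit_preWienerMeasure_holds⟩
  have h₆ : RandomPlanarGeometry.ae_isSimpleTrace_sleTrace_of_le_four (κ := (8 : ℝ≥0) / 3) :=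
    fun _ h4 ↦ ae_isSimpleTrace_sleTrace_of_hasSLETrace hgen h4
  have hswallow : sle_swallowingTime_ofReal_eq_firstHit := sle_swallowingTime_ofReal_eq_firstHit_holds
  have huniq : IsStarHull.existsUnique_isRestrictionMap := IsStarHull.existsUnique_isRestrictionMap_holds
  have h63 : IsSmoothHull.restrictionDerivVanishesAtHit :=
    restrictionDerivVanishesAtHit_of_stolz IsSmoothHull.hitPath_stolz_holds
  have hAs : IsStarHull A := hA'.elim (fun h ↦ h.1) (fun h ↦ h.1)
  obtain ⟨Y, hY⟩ := hM hAs
  exact hY.measure_disjoint_eq_of_limits huniq hAs hΦ hd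
    (sle_restrictionDeriv_frequently_gt_of_isPlusHull_or_isMinusHull_of_hasSLETrace hgen hA')
    (sle_restrictionDeriv_frequently_lt_of_vanishesAtHit hgen h₆ hswallow hAs (h63 hA hAs))

/-! ### [LSW] Thm. 6.1 for all hulls of `𝒬₊ ∪ 𝒬₋`, by smooth approximation -/


/-- **Thm. 6.1 along a smooth approximation, from `HasSLETrace (8/3)` and Prop. 5.2/5.3** — as
`sle_measure_disjoint_eq_of_hasSmoothApprox'` (`SLERestrictionSimple`).
[cite: LawlerSchrammWerner2003Restriction, proof of Thm. 6.1 (§6) with Prop. 3.3 (4) ⇒ (3) and Lemma 2.1] -/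
theorem sle_measure_disjoint_eq_of_hasSmoothApprox_of_hasSLETrace (hgen : HasSLETrace ((8 : ℝ≥0) / 3))
    (hM : sle_exists_isRestrictionMartingale) (happ : HasSmoothApprox A)
    {Φ : ConformalEquiv (upperHalfPlaneSet \ A) upperHalfPlaneSet} (hΦ : IsRestrictionMap A Φ)
    {d : ℝ} (hd : HasRestrictionDeriv A Φ d) :
    Process.preWienerMeasure {ω | Disjoint (range (sleTrace ((8 : ℝ≥0) / 3) ω)) A} =
      ENNReal.ofReal (d ^ ((5 : ℝ) / 8)) := by
  haveI : Fact Process.isProjectiveLimit_preWienerMeasure := ⟨isProjectiveLimit_preWienerMeasure_holds⟩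
  have h₆ : RandomPlanarGeometry.ae_isSimpleTrace_sleTrace_of_le_four (κ := (8 : ℝ≥0) / 3) :=
    fun _ h4 ↦ ae_isSimpleTrace_sleTrace_of_hasSLETrace hgen h4
  have htr := tendsto_norm_sleTrace_atTop_eightThirds_of_hasSLETrace hgen
  have huniq : IsStarHull.existsUnique_isRestrictionMap := IsStarHull.existsUnique_isRestrictionMap_holds
  have hex : IsStarHull.exists_hasRestrictionDeriv := IsStarHull.exists_hasRestrictionDeriv_holds
  obtain ⟨J, F, hJs, hJpm, hJm, hJi, hAF, hFA, h0F, hconv⟩ := happ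
  have hJst : ∀ n, IsStarHull (J n) := fun n ↦ (hJpm n).elim (fun h ↦ h.1) (fun h ↦ h.1)
  -- restriction data of the `J n`
  have hdata : ∀ n, ∃ (Ψ : ConformalEquiv (upperHalfPlaneSet \ J n) upperHalfPlaneSet) (e : ℝ),
      IsRestrictionMap (J n) Ψ ∧ HasRestrictionDeriv (J n) Ψ e := fun n ↦ by
    obtain ⟨Ψ, hΨ, -⟩ := huniq (hJst n)
    obtain ⟨e, -, -, he⟩ := hex (hJst n) hΨ
    exact ⟨Ψ, e, hΨ, he⟩
  choose Ψ dn hΨ hdn using hdata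
  have hlim : Tendsto dn atTop (𝓝 d) := hconv Φ Ψ d dn hΦ hd hΨ hdn
  -- the increasing events `{γ ∩ J n = ∅}`
  set γ : (ℝ≥0 → ℝ) → ℝ≥0 → ℂ := fun ω ↦ sleTrace ((8 : ℝ≥0) / 3) ω with hγdef
  set E : ℕ → Set (ℝ≥0 → ℝ) := fun n ↦ {ω | Disjoint (range (γ ω)) (J n)} with hE
  have hEn : ∀ n, Process.preWienerMeasure (E n) = ENNReal.ofReal (dn n ^ ((5 : ℝ) / 8)) := fun n ↦
    sle_measure_disjoint_eq_of_isSmoothHull_of_hasSLETrace hgen hM (hJs n) (hJpm n) (hΨ n) (hdn n)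
  have hmono : Monotone E := fun m n hmn ω hω ↦ Disjoint.mono_right (hJm hmn) hω
  have h1 : Tendsto (Process.preWienerMeasure ∘ E) atTop (𝓝 (Process.preWienerMeasure (⋃ n, E n))) :=
    tendsto_measure_iUnion_atTop hmono
  have h2 : Tendsto (Process.preWienerMeasure ∘ E) atTop (𝓝 (ENNReal.ofReal (d ^ ((5 : ℝ) / 8)))) := by
    have : Process.preWienerMeasure ∘ E = fun n ↦ ENNReal.ofReal (dn n ^ ((5 : ℝ) / 8)) := funext hEn
    rw [this]
    exact ENNReal.tendsto_ofReal (hlim.rpow_const (Or.inr (by norm_num)))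
  have hU : Process.preWienerMeasure (⋃ n, E n) = ENNReal.ofReal (d ^ ((5 : ℝ) / 8)) :=
    tendsto_nhds_unique h1 h2
  -- `{γ ∩ A = ∅} = ⋃ₙ {γ ∩ J n = ∅}` almost surely
  have hκ0 : (0 : ℝ≥0) < 8 / 3 := by positivity
  have hκ4 : (8 : ℝ≥0) / 3 ≤ 4 := by
    rw [div_le_iff₀ (by norm_num : (0 : ℝ≥0) < 3)]
    norm_num
  have hae : {ω | Disjoint (range (γ ω)) A} =ᵐ[Process.preWienerMeasure] ⋃ n, E n := by
    refine Filter.eventuallyEq_set.2 ?_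
    filter_upwards [ae_isGeneratedByCurve_sleTrace hgen, h₆ hκ0 hκ4, htr] with ω hgenω hsω htrω
    simp only [mem_setOf_eq, mem_iUnion, hE]
    constructor
    · intro hω
      have h00 : γ ω 0 = 0 := by
        show sleTrace ((8 : ℝ≥0) / 3) ω 0 = 0
        rw [hgenω.apply_zero, sleDriving_zero, Complex.ofReal_zero]
      exact exists_disjoint_of_disjoint_of_iInter_eq hgenω.continuous h00 hsω htrω
        (fun n ↦ (hJst n).isBoundedHull.isClosed) (hJst 0).isBoundedHull.1 hJm hJi hFA h0F hω
    · rintro ⟨n, hn⟩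
      exact hn.mono_right (hAF.trans (hJi ▸ iInter_subset J n))
  rw [measure_congr hae, hU]

/-- **[LSW] Thm. 6.1 for every `A ∈ 𝒬₊ ∪ 𝒬₋`, from `HasSLETrace (8/3)` and Prop. 5.2/5.3** — as
`sle_measure_disjoint_eq_of_isPlusHull_or_isMinusHull'` (`SLERestrictionSimple`), Lemma 2.1 being
the theorem `IsPlusHull.exists_antitone_isSmoothHull_holds`.
[cite: LawlerSchrammWerner2003Restriction, Thm. 6.1 and its proof (§6), one-sided hulls] -/
theorem sle_measure_disjoint_eq_of_isPlusHull_or_isMinusHull_of_hasSLETrace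
    (hgen : HasSLETrace ((8 : ℝ≥0) / 3)) (hM : sle_exists_isRestrictionMartingale)
    (hA : IsPlusHull A ∨ IsMinusHull A)
    {Φ : ConformalEquiv (upperHalfPlaneSet \ A) upperHalfPlaneSet} (hΦ : IsRestrictionMap A Φ)
    {d : ℝ} (hd : HasRestrictionDeriv A Φ d) :
    Process.preWienerMeasure {ω | Disjoint (range (sleTrace ((8 : ℝ≥0) / 3) ω)) A} =
      ENNReal.ofReal (d ^ ((5 : ℝ) / 8)) := by
  haveI : Fact Process.isProjectiveLimit_preWienerMeasure := ⟨isProjectiveLimit_preWienerMeasure_holds⟩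
  have huniq : IsStarHull.existsUnique_isRestrictionMap := IsStarHull.existsUnique_isRestrictionMap_holds
  have h21 : IsPlusHull.exists_antitone_isSmoothHull := IsPlusHull.exists_antitone_isSmoothHull_holds
  rcases A.eq_empty_or_nonempty with rfl | hne
  · -- the empty hull
    have hd1 : d = 1 :=
      HasRestrictionDeriv.eq_of_isRestrictionMap huniq isStarHull_empty isRestrictionMap_empty hΦ
        hasRestrictionDeriv_empty hd
    subst hd1
    simp [Real.one_rpow]
  · exact sle_measure_disjoint_eq_of_hasSmoothApprox_of_hasSLETrace hgen hM
      (hasSmoothApprox_of_plus_or_minus h21 hA hne) hΦ hd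

end Smooth

/-! ### [LSW] Thm. 6.1, two-sided assembly -/

/-- **[LSW] Lemma 6.2 for SLE_{8/3} and a two-sided hull `A = A₊ ∪ A₋`, from `HasSLETrace (8/3)`
alone** — as `sle_restrictionDeriv_frequently_gt_of_union'` (`SLERestrictionSimple`).
[cite: LawlerSchrammWerner2003Restriction, Lemma 6.2 and proof of Thm. 6.1 (§6), with Prop. 4.1] -/
theorem sle_restrictionDeriv_frequently_gt_of_union_of_hasSLETrace
    (hgen : HasSLETrace ((8 : ℝ≥0) / 3)) {A Ap Am : Set ℂ} (hA : IsStarHull A) (hAp : IsPlusHull Ap)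
    (hAm : IsMinusHull Am) (hunion : Ap ∪ Am = A) : sle_restrictionDeriv_frequently_gt A := by
  have h₆ : RandomPlanarGeometry.ae_isSimpleTrace_sleTrace_of_le_four (κ := (8 : ℝ≥0) / 3) :=
    fun _ h4 ↦ ae_isSimpleTrace_sleTrace_of_hasSLETrace hgen h4
  have htr := tendsto_norm_sleTrace_atTop_eightThirds_of_hasSLETrace hgen
  have hswallow : sle_swallowingTime_ofReal_eq_firstHit := sle_swallowingTime_ofReal_eq_firstHit_holds
  have huniq : IsStarHull.existsUnique_isRestrictionMap := IsStarHull.existsUnique_isRestrictionMap_holds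
  have hκ0 : (0 : ℝ≥0) < 8 / 3 := by positivity
  have hκ4 : (8 : ℝ≥0) / 3 ≤ 4 := by
    rw [div_le_iff₀ (by norm_num : (0 : ℝ≥0) < 3)]
    norm_num
  obtain ⟨Φ, hΦ, -⟩ := huniq hA
  obtain ⟨Φp, hΦp, -⟩ := huniq hAp.1
  obtain ⟨Φm, hΦm, -⟩ := huniq hAm.1
  filter_upwards [ae_isGeneratedByCurve_sleTrace hgen, h₆ hκ0 hκ4, htr] with ω hgenω hsω htrω
    hT ε hε
  set W := sleDriving ((8 : ℝ≥0) / 3) ω with hWdef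
  have hW : Continuous W := continuous_sleDriving _ ω
  have hW0 : W 0 = 0 := sleDriving_zero _ _
  have hγA : Disjoint (range (sleTrace ((8 : ℝ≥0) / 3) ω)) A := firstHit_eq_top_iff_disjoint.1 hT
  have hγp : Disjoint (range (sleTrace ((8 : ℝ≥0) / 3) ω)) Ap :=
    hγA.mono_right (hunion ▸ subset_union_left)
  have hγm : Disjoint (range (sleTrace ((8 : ℝ≥0) / 3) ω)) Am :=
    hγA.mono_right (hunion ▸ subset_union_right)
  have hε2 : 0 < ε / 2 := by linarith
  obtain ⟨r₁, hr₁⟩ := Loewner.restrictionDeriv_exitTime_gt_simple_holds hW hW0 hgenω hsω hAp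
    (disjoint_closedHull hswallow hgenω hsω hγp) (ε / 2) hε2
  obtain ⟨r₂, hr₂⟩ := Loewner.restrictionDeriv_exitTime_gt_of_isMinusHull_simple hW hW0 hgenω hsω hAm
    (disjoint_closedHull hswallow hgenω hsω hγm) hε2
  rw [frequently_atTop]
  intro a
  obtain ⟨r, hr, t, hat, ht⟩ := exists_isExitTime_ge hswallow hgenω hsω htrω a (max r₁ r₂)
  refine ⟨t, hat, fun Ψ e hΨ he ↦ ?_⟩
  -- the three slid hulls are `*`-hulls, the slid hull of `A` being the union of the others
  have hdj : ∀ {B : Set ℂ}, Disjoint (range (sleTrace ((8 : ℝ≥0) / 3) ω)) B →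
      Disjoint (sleTrace ((8 : ℝ≥0) / 3) ω '' Icc 0 t) B := fun h ↦
    h.mono_left (image_subset_range _ _)
  have hB : IsStarHull (Loewner.slidHull W A t) := hgenω.isStarHull_slidHull hW hW0 hsω hA hΦ (hdj hγA)
  have hBp : IsStarHull (Loewner.slidHull W Ap t) :=
    hgenω.isStarHull_slidHull hW hW0 hsω hAp.1 hΦp (hdj hγp)
  have hBm : IsStarHull (Loewner.slidHull W Am t) :=
    hgenω.isStarHull_slidHull hW hW0 hsω hAm.1 hΦm (hdj hγm)
  have hBunion : Loewner.slidHull W Ap t ∪ Loewner.slidHull W Am t = Loewner.slidHull W A t := by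
    rw [← Loewner.slidHull_union, hunion]
  -- restriction data of the slid parts, and Lemma 6.2 for each
  obtain ⟨Ψp, hΨp, -⟩ := huniq hBp
  obtain ⟨ep, -, -, hep⟩ := IsStarHull.exists_hasRestrictionDeriv_holds hBp hΨp
  obtain ⟨Ψm, hΨm, -⟩ := huniq hBm
  obtain ⟨em, -, -, hem⟩ := IsStarHull.exists_hasRestrictionDeriv_holds hBm hΨm
  have h1 : 1 - ε / 2 < ep := hr₁ r ((le_max_left _ _).trans hr) t ht Ψp ep hΨp hep
  have h2 : 1 - ε / 2 < em := hr₂ r ((le_max_right _ _).trans hr) t ht Ψm em hΨm hem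
  -- subadditivity
  have hsub := HasRestrictionDeriv.one_sub_le_add hBp hBm hB hBunion hΨp hΨm hΨ hep hem he
  linarith

/-! ### Assembly: `sle_restriction_eightThirds` from `HasSLETrace (8/3)` and Prop. 5.2/5.3 -/


/-- **[LSW] Thm. 6.1 (`sle_restriction_eightThirds`: `P[γ ∩ A = ∅] = Φ'_A(0)^{5/8}` for every
`A ∈ 𝒬*`) from TWO inputs: SLE_{8/3} is generated by a curve (`hgen`, Rohde–Schramm Thm. 5.1 at
`κ = 8/3`) and the restriction martingale exists (`hM`, [LSW] Prop. 5.2/5.3).** As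
`sle_restriction_eightThirds_of_printed_facts'` (`SLERestrictionSimple`), with: simplicity of the
trace (Rohde–Schramm Thm. 6.1, `ae_isSimpleTrace_sleTrace_of_hasSLETrace`), its transience
(Thm. 7.1, `tendsto_norm_sleTrace_atTop_eightThirds_of_hasSLETrace`), the swallowing
identification (`sle_swallowingTime_ofReal_eq_firstHit_holds`), measurability of the trace
(`aemeasurable_sleTrace_holds`), [LSW] Lemma 6.3 (`restrictionDerivVanishesAtHit_of_stolz
hitPath_stolz_holds`), Lemma 2.1 (`exists_antitone_isSmoothHull_holds`), `Φ_A` / `Φ'_A(0)`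
(`existsUnique_isRestrictionMap_holds`, `exists_hasRestrictionDeriv_holds`) and the domination
`sle_restrictionDeriv_dominated_of_subset` all supplied by their proofs in the tree.
[cite: LawlerSchrammWerner2003Restriction, Thm. 6.1 and its proof (§6)] -/
theorem sle_restriction_eightThirds_of_hasSLETrace (hgen : HasSLETrace ((8 : ℝ≥0) / 3))
    (hM : sle_exists_isRestrictionMartingale) : sle_restriction_eightThirds := by
  haveI : Fact Process.isProjectiveLimit_preWienerMeasure := ⟨isProjectiveLimit_preWienerMeasure_holds⟩
  have h₆ : RandomPlanarGeometry.ae_isSimpleTrace_sleTrace_of_le_four (κ := (8 : ℝ≥0) / 3) :=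
    fun _ h4 ↦ ae_isSimpleTrace_sleTrace_of_hasSLETrace hgen h4
  have huniq : IsStarHull.existsUnique_isRestrictionMap := IsStarHull.existsUnique_isRestrictionMap_holds
  have hex : IsStarHull.exists_hasRestrictionDeriv := IsStarHull.exists_hasRestrictionDeriv_holds
  have hmeas : ∀ t : ℝ≥0, AEMeasurable (fun ω ↦ sleTrace ((8 : ℝ≥0) / 3) ω t) Process.preWienerMeasure :=
    aemeasurable_sleTrace_holds hgen
  have hdom : ∀ {A A' : Set ℂ}, IsStarHull A → IsStarHull A' → A' ⊆ A →
      sle_restrictionDeriv_dominated A A' := fun hA hA' hsub ↦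
    sle_restrictionDeriv_dominated_of_subset huniq hgen h₆ hA hA' hsub
  intro A hA Φ hΦ d hd
  have one_sided : ∀ {B : Set ℂ}, IsPlusHull B ∨ IsMinusHull B →
      ∀ {Ψ : ConformalEquiv (upperHalfPlaneSet \ B) upperHalfPlaneSet}, IsRestrictionMap B Ψ →
        ∀ {e : ℝ}, HasRestrictionDeriv B Ψ e →
          Process.preWienerMeasure {ω | Disjoint (range (sleTrace ((8 : ℝ≥0) / 3) ω)) B} =
            ENNReal.ofReal (e ^ ((5 : ℝ) / 8)) := fun hB _ hΨ _ he ↦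
    sle_measure_disjoint_eq_of_isPlusHull_or_isMinusHull_of_hasSLETrace hgen hM hB hΨ he
  -- the `±`-decomposition
  have hnf := hA.isBoundedHull.isConnected_union_im_nonpos
  obtain ⟨hP, hMi, hunion, -, -, -⟩ := hA.sidePart_decomposition hnf
  set Ap := sidePart A 1 with hAp
  set Am := sidePart A (-1) with hAm
  rcases Am.eq_empty_or_nonempty with hm0 | hnem
  · -- `A = A₊` is a `+`-hull
    have hAeq : Ap = A := by rw [← hunion, hm0, union_empty]
    exact one_sided (Or.inl (hAeq ▸ hP)) hΦ hd
  rcases Ap.eq_empty_or_nonempty with hp0 | hnep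
  · -- `A = A₋` is a `−`-hull
    have hAeq : Am = A := by rw [← hunion, hp0, empty_union]
    exact one_sided (Or.inr (hAeq ▸ hMi)) hΦ hd
  -- two-sided: data and martingales for the parts
  obtain ⟨Φp, hΦp, -⟩ := huniq hP.1
  obtain ⟨dp, -, -, hdp⟩ := hex hP.1 hΦp
  obtain ⟨Φm, hΦm, -⟩ := huniq hMi.1
  obtain ⟨dm, -, -, hdm⟩ := hex hMi.1 hΦm
  obtain ⟨Y, hY⟩ := hM hA
  obtain ⟨Yp, hYp⟩ := hM hP.1
  obtain ⟨Ym, hYm⟩ := hM hMi.1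
  exact sle_measure_disjoint_eq_of_sideParts huniq hex hmeas hA hunion hP.1 hMi.1 hY hYp hYm
    (sle_restrictionDeriv_frequently_gt_of_union_of_hasSLETrace hgen hA hP hMi hunion)
    (sle_restrictionDeriv_frequently_gt_of_isPlusHull_or_isMinusHull_of_hasSLETrace hgen (Or.inl hP))
    (sle_restrictionDeriv_frequently_gt_of_isPlusHull_or_isMinusHull_of_hasSLETrace hgen (Or.inr hMi))
    hΦp hdp (one_sided (Or.inl hP) hΦp hdp) hΦm hdm (one_sided (Or.inr hMi) hΦm hdm)
    (hdom hA hP.1 (hunion ▸ subset_union_left)) (hdom hA hMi.1 (hunion ▸ subset_union_right))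
    hΦ hd

/-! ### Chordal SLE_κ through a prescribed uniformizing map, transience at `κ` only -/

section Through

open scoped _root_.unitInterval

variable {κ : ℝ≥0} {D : DobrushinDomain} {φ : ConformalEquiv upperHalfPlaneSet D.carrier}

/-- **Chordal SLE_κ in `(D; a, b)` through a prescribed uniformizing map** — as
`exists_isSLECurve_through` (`SLELawTransport`), with the transience of the SLE_κ trace assumed
at the single value `κ` (`htr`) instead of the named fact `tendsto_norm_sleTrace_atTop` for all
`κ`; proof verbatim. Lawler (2005), §6.3. [cite: Lawler2005, §6.3] -/
theorem exists_isSLECurve_through_of_ae_tendsto (hκt : HasSLETrace κ)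
    (htr : ∀ᵐ ω ∂Process.preWienerMeasure, Tendsto (fun t ↦ ‖sleTrace κ ω t‖) atTop atTop)
    (hext : JordanDomain.continuousOn_boundaryExtension)
    (hmeas : ∀ t : ℝ≥0, AEMeasurable (fun ω ↦ sleTrace κ ω t) Process.preWienerMeasure)
    (hφ : D.IsChordalUniformizing φ) :
    ∃ Γ : (ℝ≥0 → ℝ) → CurveClass ℂ, AEMeasurable Γ Process.preWienerMeasure ∧
      ∀ᵐ ω ∂Process.preWienerMeasure, Loewner.IsGeneratedByCurve (sleDriving κ ω) (sleTrace κ ω) ∧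
        ∃ c : Curve ℂ, Γ ω = CurveClass.mk c ∧
          IsCompactifiedImage φ.boundaryExtension (sleTrace κ ω) (D.pt 1) c := by
  classical
  set Φ : ℂ → ℂ := φ.boundaryExtension with hΦdef
  set b : ℂ := D.pt 1 with hbdef
  have hΦcont : ContinuousOn Φ (closure upperHalfPlaneSet) := hext D.toJordanDomain φ
  have hΦinf : Tendsto Φ (cocompact ℂ ⊓ 𝓟 (closure upperHalfPlaneSet)) (𝓝 b) :=
    φ.tendsto_boundaryExtension_cocompact hΦcont hφ.2
  set γ : (ℝ≥0 → ℝ) → ℝ≥0 → ℂ := fun ω ↦ sleTrace κ ω with hγdef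
  -- a countable dense set of parameters and measurable modifications of the marginals there
  obtain ⟨S, hSc, hSd⟩ := TopologicalSpace.exists_countable_dense I
  haveI : Countable S := hSc.to_subtype
  have hm : ∀ s : S, AEMeasurable (fun ω ↦ γ ω (rayParam s)) Process.preWienerMeasure :=
    fun s ↦ hmeas (rayParam s)
  set g : S → (ℝ≥0 → ℝ) → ℂ := fun s ↦ (hm s).mk _ with hgdef
  have hgm : ∀ s, Measurable (g s) := fun s ↦ (hm s).measurable_mk
  -- the good event, of full measure
  set G : Set (ℝ≥0 → ℝ) := {ω | Loewner.IsGeneratedByCurve (sleDriving κ ω) (γ ω) ∧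
    Tendsto (fun t ↦ ‖γ ω t‖) atTop atTop ∧ ∀ s : S, γ ω (rayParam s) = g s ω} with hGdef
  have hG : ∀ᵐ ω ∂Process.preWienerMeasure, ω ∈ G := by
    have h3 : ∀ᵐ ω ∂Process.preWienerMeasure, ∀ s : S, γ ω (rayParam s) = g s ω :=
      ae_all_iff.2 fun s ↦ (hm s).ae_eq_mk
    filter_upwards [ae_isGeneratedByCurve_sleTrace hκt, htr, h3] with ω h1 h2 h3
    exact ⟨h1, h2, h3⟩
  obtain ⟨N, hGN, hNm, hN0⟩ := exists_measurable_superset_of_null (ae_iff.1 hG)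
  have hgood : ∀ ω, ω ∈ Nᶜ → ω ∈ G := fun ω hω ↦ by
    by_contra hωG
    exact hω (hGN hωG)
  have hae : ∀ᵐ ω ∂Process.preWienerMeasure, ω ∈ Nᶜ := measure_eq_zero_iff_ae_notMem.1 hN0
  -- the curve on the good event
  have hcurve : ∀ ω, ω ∈ Nᶜ → Continuous (nodeValue Φ b (γ ω)) := fun ω hω ↦
    continuous_nodeValue hΦcont hΦinf (hgood ω hω).1.continuous
      (fun t ↦ sleTrace_mem_closure κ ω t) (tendsto_cocompact_of_tendsto_norm_atTop (hgood ω hω).2.1)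
  set f : (Nᶜ : Set (ℝ≥0 → ℝ)) → CurveClass ℂ :=
    fun ω ↦ CurveClass.mk ⟨⟨nodeValue Φ b (γ ω), hcurve ω ω.2⟩⟩ with hfdef
  -- measurability of `f` on the good event
  have hf : Measurable f := by
    refine measurable_curveClassMk (fun ω : (Nᶜ : Set (ℝ≥0 → ℝ)) ↦ hcurve ω ω.2) hSc hSd ?_
    intro s hs
    by_cases hs1 : (s : ℝ) < 1
    · have hΦr : Continuous ((closure upperHalfPlaneSet).restrict Φ) :=
        continuousOn_iff_continuous_restrict.1 hΦcont
      have hgs : Measurable fun ω : (Nᶜ : Set (ℝ≥0 → ℝ)) ↦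
          (⟨γ ω (rayParam s), sleTrace_mem_closure κ ω _⟩ : closure upperHalfPlaneSet) := by
        refine Measurable.subtype_mk ?_
        have heq : (fun ω : (Nᶜ : Set (ℝ≥0 → ℝ)) ↦ γ ω (rayParam s)) =
            fun ω : (Nᶜ : Set (ℝ≥0 → ℝ)) ↦ g ⟨s, hs⟩ ω :=
          funext fun ω ↦ (hgood ω ω.2).2.2 ⟨s, hs⟩
        rw [heq]
        exact (hgm ⟨s, hs⟩).comp measurable_subtype_coe
      have heq : (fun ω : (Nᶜ : Set (ℝ≥0 → ℝ)) ↦ nodeValue Φ b (γ ω) s) =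
          fun ω : (Nᶜ : Set (ℝ≥0 → ℝ)) ↦ (closure upperHalfPlaneSet).restrict Φ
            ⟨γ ω (rayParam s), sleTrace_mem_closure κ ω _⟩ :=
        funext fun ω ↦ nodeValue_of_lt Φ b (γ ω) hs1
      rw [heq]
      exact hΦr.measurable.comp hgs
    · obtain rfl : s = 1 := Subtype.ext (le_antisymm s.2.2 (not_lt.1 hs1))
      simp only [nodeValue_one]
      exact measurable_const
  -- the random curve
  refine ⟨fun ω ↦ if hω : ω ∈ Nᶜ then f ⟨ω, hω⟩ else CurveClass.mk (Curve.const b), ?_, ?_⟩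
  · exact (Measurable.dite hf measurable_const hNm.compl).aemeasurable
  · filter_upwards [hae] with ω hω
    refine ⟨(hgood ω hω).1, ⟨⟨nodeValue Φ b (γ ω), hcurve ω hω⟩⟩, ?_, ?_, ?_⟩
    · simp only [dif_pos hω, hfdef]
    · intro s hs
      exact nodeValue_of_lt Φ b (γ ω) hs
    · exact nodeValue_one Φ b (γ ω)

end Through

/-! ### Touching the pulled-back hull without entering it is null, from Thm. 6.1 and `HasSLETrace (8/3)` -/

section Null

variable {D D' : DobrushinDomain} {φ : ConformalEquiv upperHalfPlaneSet D.carrier}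

/-- **Touching the pulled-back hull without entering it is a null event for SLE_{8/3}** — as
`measure_subset_closure_le_measure_avoid` (`HullRestrictionNull`): `P[γ(0,∞) ⊆ closure (ℍ ∖ A)]
≤ P[γ[0,∞) ∩ A = ∅]` for the pulled-back hull `A` of a hull subdomain, from [LSW] Thm. 6.1 in
the half-plane (`h61`) and `HasSLETrace (8/3)`; the continuity of `Φ'_·(0)` under kernel
convergence ([LSW] Lemma 3.5, `HasRestrictionDeriv.tendsto_of_kernel_holds`), `Φ_A`, `Φ'_A(0)`,
the simple-connectivity criterion, Jordan–Schoenflies, the Jordan curve theorem, Carathéodory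
and the simplicity and transience of the SLE_{8/3} trace are supplied by their proofs.
[cite: LawlerSchrammWerner2003Restriction, Thm. 6.1 (p. 23) with Lemma 3.5 (p. 12)] -/
theorem measure_subset_closure_le_measure_avoid_of_hasSLETrace (hφ : D.IsChordalUniformizing φ)
    (hD' : D.IsHullSubdomain D') (h61 : sle_restriction_eightThirds)
    (hκt : HasSLETrace ((8 : ℝ≥0) / 3)) :
    Process.preWienerMeasure {ω | ∀ t, 0 < t →
        sleTrace ((8 : ℝ≥0) / 3) ω t ∈ closure (φ.pullbackDomain D')} ≤
      Process.preWienerMeasure {ω | Disjoint (range (sleTrace ((8 : ℝ≥0) / 3) ω)) (φ.pullbackHull D')} := by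
  have hexΦ : IsStarHull.existsUnique_isRestrictionMap := IsStarHull.existsUnique_isRestrictionMap_holds
  have hex : IsStarHull.exists_hasRestrictionDeriv := IsStarHull.exists_hasRestrictionDeriv_holds
  have hFc : HasRestrictionDeriv.tendsto_of_kernel := HasRestrictionDeriv.tendsto_of_kernel_holds
  have hFa : isSimplyConnected_of_isConnected_compl := isSimplyConnected_of_isConnected_compl_holds
  have hsc : ∀ D : JordanDomain, D.isSimplyConnected := JordanDomain.isSimplyConnected_holds
  have hJ : Literature.Topology.PlaneTopology.JordanCurveTheorem :=
    Literature.Topology.PlaneTopology.JordanCurveTheorem_holds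
  have hC : JordanDomain.exists_continuousOn_extension := JordanDomain.exists_continuousOn_extension_holds
  have h₆ : RandomPlanarGeometry.ae_isSimpleTrace_sleTrace_of_le_four (κ := (8 : ℝ≥0) / 3) :=
    fun _ h4 ↦ ae_isSimpleTrace_sleTrace_of_hasSLETrace hκt h4
  have htr := tendsto_norm_sleTrace_atTop_eightThirds_of_hasSLETrace hκt
  -- the hull `A`, its restriction map and derivative
  have hA : IsStarHull (φ.pullbackHull D') := IsStarHull.pullbackHull hsc hφ hD'
  obtain ⟨Φ, hΦ, -⟩ := hexΦ hA
  obtain ⟨d, -, -, hd⟩ := hex hA hΦ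
  -- the exhaustion `B_n`
  set B : ℕ → Set ℂ := fun n ↦ anchoredHull (erosion φ D' n) with hB
  have hBstar : ∀ n, IsStarHull (B n) := fun n ↦ isStarHull_anchoredHull_erosion hφ hD' hsc hFa n
  have hBsub : ∀ n, B n ⊆ φ.pullbackHull D' := fun n ↦ anchoredHull_erosion_subset hφ hD' hsc n
  have hBmono : Monotone B := fun n m h ↦ anchoredHull_mono (monotone_erosion h)
  choose Φn hΦn _ using fun n ↦ hexΦ (hBstar n)
  choose dn _ _ hdn using fun n ↦ hex (hBstar n) (hΦn n)
  have hlim : Tendsto dn atTop (𝓝 d) :=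
    hFc hA hBstar hBmono hBsub (interior_iInter_diff_anchoredHull_erosion hφ hD' hsc hJ hC)
      hΦ hd hΦn hdn
  -- Thm. 6.1 for `A` and for the `B_n`
  have hPA := h61 hA hΦ hd
  have hPB : ∀ n, Process.preWienerMeasure {ω | Disjoint (range (sleTrace ((8 : ℝ≥0) / 3) ω)) (B n)} =
      ENNReal.ofReal (dn n ^ ((5 : ℝ) / 8)) := fun n ↦ h61 (hBstar n) (hΦn n) (hdn n)
  -- the event `{γ(0,∞) ⊆ closure (ℍ ∖ A)}` lies a.s. in every `{γ ∩ B_n = ∅}`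
  have hκ0 : (0 : ℝ≥0) < 8 / 3 := by positivity
  have hκ4 : (8 : ℝ≥0) / 3 ≤ 4 := by
    rw [div_le_iff₀ (by norm_num : (0 : ℝ≥0) < 3)]; norm_num
  have hbound : ∀ n, Process.preWienerMeasure {ω | ∀ t, 0 < t →
      sleTrace ((8 : ℝ≥0) / 3) ω t ∈ closure (φ.pullbackDomain D')} ≤
      ENNReal.ofReal (dn n ^ ((5 : ℝ) / 8)) := by
    intro n
    rw [← hPB n]
    refine measure_mono_ae ?_
    filter_upwards [ae_isGeneratedByCurve_sleTrace hκt, h₆ hκ0 hκ4, htr] with ω hgen hsimple htr'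
    intro hω
    have h0 : sleTrace ((8 : ℝ≥0) / 3) ω 0 = 0 := by
      change Loewner.trace (sleDriving ((8 : ℝ≥0) / 3) ω) 0 = 0
      rw [Loewner.trace_zero, sleDriving_zero, Complex.ofReal_zero]
    have h0S : (0 : ℂ) ∉ erosion φ D' n :=
      notMem_erosion_of_mem_closure (zero_mem_closure_pullbackDomain hφ hD' hsc) n
    have hdisj : Disjoint (range (sleTrace ((8 : ℝ≥0) / 3) ω)) (erosion φ D' n) := by
      refine Set.disjoint_left.2 ?_
      rintro _ ⟨t, rfl⟩ ht
      rcases eq_or_ne t 0 with rfl | htne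
      · exact h0S (h0 ▸ ht)
      · exact notMem_erosion_of_mem_closure (hω t (pos_iff_ne_zero.2 htne)) n ht
    exact disjoint_range_anchoredHull (isClosed_erosion n) (isBounded_erosion n) h0S
      hgen.continuous h0 hsimple.2 htr' hdisj
  -- pass to the limit
  rw [hPA]
  have hlim' : Tendsto (fun n ↦ ENNReal.ofReal (dn n ^ ((5 : ℝ) / 8))) atTop
      (𝓝 (ENNReal.ofReal (d ^ ((5 : ℝ) / 8)))) :=
    ENNReal.tendsto_ofReal (hlim.rpow_const (Or.inr (by norm_num)))
  exact ge_of_tendsto' hlim' hbound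

end Null

/-! ### The transposition to Dobrushin domains -/

section Main

open scoped _root_.unitInterval

/-- **[LSW] Theorem 6.1 transposed to Dobrushin domains, from Thm. 6.1 in the half-plane and
`HasSLETrace (8/3)`** — as `IsSLELaw.hullRestriction_eightThirds_of_facts_at`
(`HullRestrictionSLE`; proof verbatim): for the chordal SLE_{8/3} laws `μ`, `μ'` of `(D; a, b)`
and of a hull subdomain `D'`, `μ'(T) · μ{Γ ⊆ cl D'} = μ(T ∩ {Γ ⊆ cl D'})`. Every classical input
of that proof — `Φ_A`/`Φ'_A(0)` ([LSW] §2), simple connectivity, Jordan–Schoenflies, Jordan arc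
separation, Riemann mapping, Carathéodory, uniqueness in law of chordal SLE
(`IsSLECurve.map_eq_holds`), measurability, simplicity and transience of the SLE_{8/3} trace —
is supplied by its proof in the tree.
[cite: LawlerSchrammWerner2003Restriction, Thm. 6.1 (p. 23) with Prop. 3.3 (3) ⇒ (1) (p. 11) and Lemma 3.2 (p. 10)] -/
theorem IsSLELaw.hullRestriction_eightThirds_of_sle_restriction (h61 : sle_restriction_eightThirds)
    (hκt : HasSLETrace ((8 : ℝ≥0) / 3)) : IsSLELaw.hullRestriction_eightThirds := by
  classical
  have hexΦ : IsStarHull.existsUnique_isRestrictionMap := IsStarHull.existsUnique_isRestrictionMap_holds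
  have hex : IsStarHull.exists_hasRestrictionDeriv := IsStarHull.exists_hasRestrictionDeriv_holds
  have hFa : isSimplyConnected_of_isConnected_compl := isSimplyConnected_of_isConnected_compl_holds
  have hsc : ∀ D : JordanDomain, D.isSimplyConnected := JordanDomain.isSimplyConnected_holds
  have hJarc : Literature.Topology.PlaneTopology.JordanArcSeparation :=
    Literature.Topology.PlaneTopology.JordanArcSeparation_holds
  have hRM : ∀ {U : Set ℂ}, exists_conformalEquiv_ball (U := U) := exists_conformalEquiv_ball_holds
  have hC : JordanDomain.exists_continuousOn_extension := JordanDomain.exists_continuousOn_extension_holds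
  have h₆ : RandomPlanarGeometry.ae_isSimpleTrace_sleTrace_of_le_four (κ := (8 : ℝ≥0) / 3) :=
    fun _ h4 ↦ ae_isSimpleTrace_sleTrace_of_hasSLETrace hκt h4
  have htr := tendsto_norm_sleTrace_atTop_eightThirds_of_hasSLETrace hκt
  have h₃ : ∀ {D : DobrushinDomain} {Γ Γ' : (ℝ≥0 → ℝ) → CurveClass ℂ},
      IsSLECurve ((8 : ℝ≥0) / 3) D Γ → IsSLECurve ((8 : ℝ≥0) / 3) D Γ' →
        Process.preWienerMeasure.map Γ = Process.preWienerMeasure.map Γ' :=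
    fun hΓ hΓ' ↦ IsSLECurve.map_eq_holds hΓ hΓ'
  have hmeas : aemeasurable_sleTrace := aemeasurable_sleTrace_holds
  intro D D' μ μ' hμ hμ' hD' T hT
  -- constants and derived classical inputs
  have hκ0 : (0 : ℝ≥0) < 8 / 3 := by positivity
  have hκ4 : (8 : ℝ≥0) / 3 ≤ 4 := by
    rw [div_le_iff₀ (by norm_num : (0 : ℝ≥0) < 3)]
    norm_num
  haveI hP : IsProbabilityMeasure Process.preWienerMeasure :=
    ⟨sle_restriction_eightThirds.measure_univ h61⟩
  have hext : JordanDomain.continuousOn_boundaryExtension :=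
    JordanDomain.continuousOn_boundaryExtension_of_disc hC
  have h₈ : JordanDomain.mapsTo_boundaryExtension := JordanDomain.mapsTo_boundaryExtension_of_disc hC
  have h₉ : CurveClass.measurableSet_simple (E := ℂ) := CurveClass.measurableSet_simple_holds
  -- the SLE curve of `D`, its uniformizing map `φ`, the pulled-back hull and `Φ = Φ_A`
  obtain ⟨Γ, hΓ, rfl⟩ := hμ
  obtain ⟨hΓm, φ, hφ, hΓae⟩ := hΓ
  have hA : IsStarHull (φ.pullbackHull D') := IsStarHull.pullbackHull hsc hφ hD'
  have hAc : IsClosed (φ.pullbackHull D') := hA.isBoundedHull.isClosed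
  obtain ⟨Φ, hΦ, -⟩ := hexΦ hA
  -- the uniformizing map `ψ = φ ∘ Φ⁻¹` of `D'` and the SLE law of `D'` through it
  set ψ : ConformalEquiv upperHalfPlaneSet D'.carrier :=
    Φ.symm.trans (φ.restrHull D' hD'.carrier_subset) with hψdef
  have hψ : D'.IsChordalUniformizing ψ :=
    MarkedDomain.IsChordalUniformizing.pullback hsc hRM hC hφ hD' hΦ
  have hψsymm : ∀ w, ψ.symm w = Φ (φ.symm w) := fun w ↦ rfl
  obtain ⟨Γ', rfl, hΓ'm, hΓ'ae⟩ : ∃ Γ' : (ℝ≥0 → ℝ) → CurveClass ℂ,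
      μ' = Process.preWienerMeasure.map Γ' ∧ AEMeasurable Γ' Process.preWienerMeasure ∧
      ∀ᵐ ω ∂Process.preWienerMeasure, Loewner.IsGeneratedByCurve (sleDriving ((8 : ℝ≥0) / 3) ω)
          (sleTrace ((8 : ℝ≥0) / 3) ω) ∧
        ∃ c : Curve ℂ, Γ' ω = CurveClass.mk c ∧
          IsCompactifiedImage ψ.boundaryExtension (sleTrace ((8 : ℝ≥0) / 3) ω) (D'.pt 1) c := by
    obtain ⟨Γ', hΓ'm, hΓ'⟩ := exists_isSLECurve_through_of_ae_tendsto hκt htr hext (hmeas hκt) hψ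
    obtain ⟨Γ₀, hΓ₀, rfl⟩ := hμ'
    exact ⟨Γ', h₃ hΓ₀ (IsSLECurve.of_through hψ hΓ'm hΓ'), hΓ'm, hΓ'⟩
  have hΓsl : IsSLELaw ((8 : ℝ≥0) / 3) D (Process.preWienerMeasure.map Γ) := ⟨Γ, ⟨hΓm, φ, hφ, hΓae⟩, rfl⟩
  have hΓ'sl : IsSLELaw ((8 : ℝ≥0) / 3) D' (Process.preWienerMeasure.map Γ') :=
    (IsSLECurve.of_through hψ hΓ'm hΓ'ae).isSLELaw_map
  haveI : IsProbabilityMeasure (Process.preWienerMeasure.map Γ') := Measure.isProbabilityMeasure_map hΓ'm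
  -- the good event
  have hgood : ∀ᵐ ω ∂Process.preWienerMeasure,
      Loewner.IsGeneratedByCurve (sleDriving ((8 : ℝ≥0) / 3) ω) (sleTrace ((8 : ℝ≥0) / 3) ω) ∧
      Loewner.IsSimpleTrace (sleTrace ((8 : ℝ≥0) / 3) ω) ∧
      Tendsto (fun t ↦ ‖sleTrace ((8 : ℝ≥0) / 3) ω t‖) atTop atTop ∧
      (∃ c : Curve ℂ, Γ ω = CurveClass.mk c ∧
        IsCompactifiedImage φ.boundaryExtension (sleTrace ((8 : ℝ≥0) / 3) ω) (D.pt 1) c) ∧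
      (∃ c' : Curve ℂ, Γ' ω = CurveClass.mk c' ∧
        IsCompactifiedImage ψ.boundaryExtension (sleTrace ((8 : ℝ≥0) / 3) ω) (D'.pt 1) c') ∧
      (Γ ω ∈ CurveClass.simple ∧ (Γ ω).source = D.pt 0 ∧ (Γ ω).target = D.pt 1) := by
    filter_upwards [hΓae, h₆ hκ0 hκ4, htr, hΓ'ae,
      ae_of_ae_map hΓm (hΓsl.ae_simple h₆ h₉ hκ0 hκ4), ae_of_ae_map hΓm (hΓsl.ae_endpoints h₈)]
      with ω hω hs ht hω' h1 h2
    exact ⟨hω.1, hs, ht, hω.2, hω'.2, h1.1, h2.1, h2.2.1⟩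
  -- the events
  set V : Set (CurveClass ℂ) := CurveClass.rangeSubset (closure D'.carrier) with hVdef
  set R : Set (CurveClass ℂ) := chordalCarrier D' with hRdef
  have hVm : MeasurableSet V := CurveClass.measurableSet_rangeSubset isClosed_closure
  have hRm : MeasurableSet R := measurableSet_chordalCarrier
  -- on the good event: `{γ ∩ A = ∅} ↔ Γ ∈ V ∩ R`, and `Γ ∈ V ⇒ γ(0,∞) ⊆ closure (ℍ ∖ A)`
  have hkey : ∀ᵐ ω ∂Process.preWienerMeasure,
      (Disjoint (range (sleTrace ((8 : ℝ≥0) / 3) ω)) (φ.pullbackHull D') ↔ Γ ω ∈ V ∩ R) ∧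
      (Γ ω ∈ V → ∀ t, 0 < t →
        sleTrace ((8 : ℝ≥0) / 3) ω t ∈ closure (φ.pullbackDomain D')) := by
    filter_upwards [hgood] with ω ⟨_, hsimple, _, ⟨c, hΓω, hc⟩, _, hΓs, hΓsrc, hΓtgt⟩
    have h0 : sleTrace ((8 : ℝ≥0) / 3) ω 0 = 0 := sleTrace_zero _ ω
    rw [hΓω] at hΓs hΓsrc hΓtgt ⊢
    refine ⟨?_, fun hV ↦
      forall_mem_closure_pullbackDomain hD'.carrier_subset hsimple.2 hc hV⟩
    rw [disjoint_range_pullbackHull_iff hφ hD' h0 hsimple.2 hc]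
    constructor
    · intro hr
      exact ⟨subset_closure_of_subset_carrier_union hr,
        ⟨⟨hΓs, hΓsrc.trans hD'.pt_zero_eq.symm⟩, hΓtgt.trans hD'.pt_one_eq.symm⟩, hr⟩
    · rintro ⟨-, hR⟩
      exact hR.2
  -- `μ V = P[γ ∩ A = ∅] = μ (V ∩ R)` (touching without entering is null, `HullRestrictionNull`)
  have hT6 := measure_subset_closure_le_measure_avoid_of_hasSLETrace hφ hD' h61 hκt
  have hmapV : Process.preWienerMeasure.map Γ V = Process.preWienerMeasure (Γ ⁻¹' V) :=
    Measure.map_apply_of_aemeasurable hΓm hVm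
  have hmapVR : Process.preWienerMeasure.map Γ (V ∩ R) = Process.preWienerMeasure (Γ ⁻¹' (V ∩ R)) :=
    Measure.map_apply_of_aemeasurable hΓm (hVm.inter hRm)
  have hle1 : Process.preWienerMeasure (Γ ⁻¹' V) ≤ Process.preWienerMeasure {ω | ∀ t, 0 < t →
      sleTrace ((8 : ℝ≥0) / 3) ω t ∈ closure (φ.pullbackDomain D')} :=
    measure_mono_ae (hkey.mono fun ω hω hV ↦ hω.2 hV)
  have hle2 : Process.preWienerMeasure {ω | Disjoint (range (sleTrace ((8 : ℝ≥0) / 3) ω))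
      (φ.pullbackHull D')} ≤ Process.preWienerMeasure (Γ ⁻¹' (V ∩ R)) :=
    measure_mono_ae (hkey.mono fun ω hω hE ↦ hω.1.1 hE)
  have hle3 : Process.preWienerMeasure (Γ ⁻¹' (V ∩ R)) ≤ Process.preWienerMeasure (Γ ⁻¹' V) :=
    measure_mono (preimage_mono inter_subset_left)
  have hVEA : Process.preWienerMeasure.map Γ V =
      Process.preWienerMeasure {ω | Disjoint (range (sleTrace ((8 : ℝ≥0) / 3) ω)) (φ.pullbackHull D')} := by
    rw [hmapV]
    exact le_antisymm (hle1.trans hT6) (hle2.trans hle3)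
  have hVR : Process.preWienerMeasure.map Γ (V ∩ R) = Process.preWienerMeasure.map Γ V := by
    rw [hmapV, hmapVR]
    exact le_antisymm hle3 ((hle1.trans hT6).trans hle2)
  have hVsubR : ∀ᵐ x ∂Process.preWienerMeasure.map Γ, x ∈ V → x ∈ R := by
    have hsum := measure_inter_add_sdiff (μ := Process.preWienerMeasure.map Γ) V hRm
    rw [hVR] at hsum
    have hnull : Process.preWienerMeasure.map Γ (V \ R) = 0 :=
      (ENNReal.add_right_inj (measure_ne_top _ _)).1 (hsum.trans (add_zero _).symm)
    filter_upwards [measure_eq_zero_iff_ae_notMem.1 hnull] with x hx hxV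
    by_contra hxR
    exact hx ⟨hxV, hxR⟩
  have hVsubR' := ae_of_ae_map hΓm hVsubR
  -- the two finite measures `μ V • μ'` and `μ|_V` agree: transfer through the avoidance code
  set m : ℝ≥0 := (Process.preWienerMeasure.map Γ V).toNNReal with hmdef
  have hmcoe : (m : ℝ≥0∞) = Process.preWienerMeasure.map Γ V := ENNReal.coe_toNNReal (measure_ne_top _ _)
  have hident : m • Process.preWienerMeasure.map Γ' = (Process.preWienerMeasure.map Γ).restrict V := by
    refine CurveClass.Measure.ext_of_missCode_injOn (C := imageTest ψ)
      (fun n ↦ isClosed_imageTest hC n) hRm (injOn_missCode_imageTest hJarc hC hψ) ?_ ?_ ?_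
    · refine Measure.ae_smul_measure ?_ _
      filter_upwards [hΓ'sl.ae_simple h₆ h₉ hκ0 hκ4, hΓ'sl.ae_endpoints h₈] with x h1 h2
      exact ⟨⟨⟨h1.1, h2.1⟩, h2.2.1⟩, subset_carrier_union_of_inter_frontier h2.2.2 h1.2⟩
    · rw [ae_restrict_iff' hVm]
      exact hVsubR
    · intro s
      obtain ⟨hS0, hSc, hSsub, h0S⟩ := biUnion_anchoredSeq s
      have havm : MeasurableSet (CurveClass.rangeSubset
          (ψ.boundaryExtension '' ⋃ n ∈ s, anchoredSeq n)ᶜ : Set (CurveClass ℂ)) :=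
        CurveClass.measurableSet_rangeSubset_compl
          (MarkedDomain.isCompact_image_boundaryExtension hC hSsub hSc).isClosed
      rw [biUnion_imageTest, Measure.coe_nnreal_smul_apply, hmcoe, Measure.restrict_apply havm,
        Measure.map_apply_of_aemeasurable hΓ'm havm,
        Measure.map_apply_of_aemeasurable hΓm (havm.inter hVm), hVEA]
      rcases hS0 with hS0 | hSanch
      · -- the empty test set: both sides are `μ V`
        have hav : (CurveClass.rangeSubset
            (ψ.boundaryExtension '' ⋃ n ∈ s, anchoredSeq n)ᶜ : Set (CurveClass ℂ)) = univ := by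
          rw [hS0, image_empty, compl_empty]
          exact eq_univ_of_forall fun c ↦ subset_univ _
        rw [hav, preimage_univ, measure_univ, mul_one, univ_inter, ← hmapV, hVEA]
      · have hScl : IsClosed (⋃ n ∈ s, anchoredSeq n) := hSc.isClosed
        have hSb : Bornology.IsBounded (⋃ n ∈ s, anchoredSeq n) := hSc.isBounded
        -- `μ' {Γ' ∩ ψ(S) = ∅} = P[γ ∩ S = ∅]`
        have hL : Process.preWienerMeasure (Γ' ⁻¹' CurveClass.rangeSubset
            (ψ.boundaryExtension '' ⋃ n ∈ s, anchoredSeq n)ᶜ) =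
            Process.preWienerMeasure {ω | Disjoint (range (sleTrace ((8 : ℝ≥0) / 3) ω))
              (⋃ n ∈ s, anchoredSeq n)} := by
          refine measure_congr (eventuallyEq_set.2 ?_)
          filter_upwards [hgood] with ω ⟨_, hsimple, _, _, ⟨c', hΓ'ω, hc'⟩, _⟩
          rw [mem_preimage, hΓ'ω]
          exact hc'.mk_mem_rangeSubset_compl_image_iff hψ (sleTrace_zero _ ω) hsimple.2 hC hSsub h0S
        -- `μ ({Γ ∩ ψ(S) = ∅} ∩ V) = P[γ ∩ A = ∅, Φ_A(γ) ∩ S = ∅]`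
        have hRt : Process.preWienerMeasure (Γ ⁻¹' (CurveClass.rangeSubset
            (ψ.boundaryExtension '' ⋃ n ∈ s, anchoredSeq n)ᶜ ∩ V)) =
            Process.preWienerMeasure {ω | Disjoint (range (sleTrace ((8 : ℝ≥0) / 3) ω))
              (φ.pullbackHull D') ∧
              ∀ t, 0 < t → Φ (sleTrace ((8 : ℝ≥0) / 3) ω t) ∉ ⋃ n ∈ s, anchoredSeq n} := by
          refine measure_congr (eventuallyEq_set.2 ?_)
          filter_upwards [hgood, hkey, hVsubR'] with ω ⟨_, hsimple, _, ⟨c, hΓω, hc⟩, _⟩ hk hVR'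
          rw [mem_preimage]
          constructor
          · rintro ⟨hav, hV⟩
            have hE : Disjoint (range (sleTrace ((8 : ℝ≥0) / 3) ω)) (φ.pullbackHull D') :=
              hk.1.2 ⟨hV, hVR' hV⟩
            refine ⟨hE, ?_⟩
            rw [hΓω] at hav
            exact (mk_mem_rangeSubset_compl_image_iff_of_disjoint hC hφ hD' hψ hψsymm
              (sleTrace_zero _ ω) hsimple.2 hc hE hSsub h0S).1 hav
          · rintro ⟨hE, hav⟩
            refine ⟨?_, (hk.1.1 hE).1⟩
            rw [hΓω]
            exact (mk_mem_rangeSubset_compl_image_iff_of_disjoint hC hφ hD' hψ hψsymm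
              (sleTrace_zero _ ω) hsimple.2 hc hE hSsub h0S).2 hav
        rw [hL, hRt]
        by_cases h0F : (0 : ℂ) ∈ hpFill (⋃ n ∈ s, anchoredSeq n)
        · -- `0` is enclosed by `S`: both events are null
          have hL0 : Process.preWienerMeasure {ω | Disjoint (range (sleTrace ((8 : ℝ≥0) / 3) ω))
              (⋃ n ∈ s, anchoredSeq n)} = 0 := by
            refine measure_eq_zero_iff_ae_notMem.2 ?_
            filter_upwards [hgood] with ω ⟨hgen, hsimple, htr', _⟩ hdisj
            exact zero_notMem_hpFill_of_disjoint hScl hgen.continuous (sleTrace_zero _ ω)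
              hsimple.2 htr' hdisj h0F
          have hR0 : Process.preWienerMeasure {ω | Disjoint (range (sleTrace ((8 : ℝ≥0) / 3) ω))
              (φ.pullbackHull D') ∧
              ∀ t, 0 < t → Φ (sleTrace ((8 : ℝ≥0) / 3) ω t) ∉ ⋃ n ∈ s, anchoredSeq n} = 0 := by
            refine measure_eq_zero_iff_ae_notMem.2 ?_
            filter_upwards [hgood] with ω ⟨hgen, hsimple, htr', _⟩ hω
            exact (hΦ.forall_notMem_hpFill hAc hgen.continuous (sleTrace_zero _ ω) hsimple.2
              htr' hω.1 hScl hSb h0S hω.2).1 h0F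
          rw [hL0, hR0, mul_zero]
        · -- the fill `B` of `S` is a `*`-hull: Thm. 6.1 and the semigroup identity
          have hB : IsStarHull (hpFill (⋃ n ∈ s, anchoredSeq n)) :=
            isStarHull_hpFill hFa hScl hSb hSanch.2 h0F
          obtain ⟨ΦB, hΦB, -⟩ := hexΦ hB
          have hL1 : Process.preWienerMeasure {ω | Disjoint (range (sleTrace ((8 : ℝ≥0) / 3) ω))
              (⋃ n ∈ s, anchoredSeq n)} =
              Process.preWienerMeasure {ω | Disjoint (range (sleTrace ((8 : ℝ≥0) / 3) ω))
                (hpFill (⋃ n ∈ s, anchoredSeq n))} := by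
            refine measure_congr (eventuallyEq_set.2 ?_)
            filter_upwards [hgood] with ω ⟨hgen, hsimple, htr', _⟩
            exact (disjoint_range_hpFill_iff hScl hSb h0S hgen.continuous (sleTrace_zero _ ω)
              hsimple.2 htr').symm
          have hR1 : Process.preWienerMeasure {ω | Disjoint (range (sleTrace ((8 : ℝ≥0) / 3) ω))
              (φ.pullbackHull D') ∧
              ∀ t, 0 < t → Φ (sleTrace ((8 : ℝ≥0) / 3) ω t) ∉ ⋃ n ∈ s, anchoredSeq n} =
              Process.preWienerMeasure {ω | Disjoint (range (sleTrace ((8 : ℝ≥0) / 3) ω))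
                (φ.pullbackHull D') ∧
                ∀ t, 0 < t → Φ (sleTrace ((8 : ℝ≥0) / 3) ω t) ∉
                  hpFill (⋃ n ∈ s, anchoredSeq n)} := by
            refine measure_congr (eventuallyEq_set.2 ?_)
            filter_upwards [hgood] with ω ⟨hgen, hsimple, htr', _⟩
            refine and_congr_right fun hE ↦ ⟨fun hav ↦ ?_, fun hav t ht hS' ↦ ?_⟩
            · exact (hΦ.forall_notMem_hpFill hAc hgen.continuous (sleTrace_zero _ ω) hsimple.2
                htr' hE hScl hSb h0S hav).2
            · exact hav t ht (inter_subset_hpFill _ ⟨hS', Φ.mapsTo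
                ⟨hsimple.2 t ht, Set.disjoint_left.1 hE (mem_range_self t)⟩⟩)
          rw [hL1, hR1, sle_restriction_eightThirds.measure_avoid_and_comp_avoid h61 hex h₆ hB hA
            hΦB hΦ]
  -- evaluate the identity of measures at `T`
  have hTeq : (m • Process.preWienerMeasure.map Γ') T = (Process.preWienerMeasure.map Γ).restrict V T := by
    rw [hident]
  rw [Measure.coe_nnreal_smul_apply, Measure.restrict_apply hT, hmcoe] at hTeq
  rw [mul_comm]
  exact hTeq

/-- **[LSW] Thm. 6.1 transposed to Dobrushin domains (`IsSLELaw.hullRestriction_eightThirds`) from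
TWO named facts**: `HasSLETrace (8/3)` (Rohde–Schramm (2005), Thm. 5.1 at `κ = 8/3`) and the
restriction martingale `sle_exists_isRestrictionMartingale` ([LSW] Prop. 5.2/5.3).
[cite: LawlerSchrammWerner2003Restriction, Thm. 6.1 (p. 23) and its proof (§6), with Prop. 3.3 (p. 11)] -/
theorem IsSLELaw.hullRestriction_eightThirds_of_hasSLETrace (hgen : HasSLETrace ((8 : ℝ≥0) / 3))
    (hM : sle_exists_isRestrictionMartingale) : IsSLELaw.hullRestriction_eightThirds :=
  IsSLELaw.hullRestriction_eightThirds_of_sle_restriction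
    (sle_restriction_eightThirds_of_hasSLETrace hgen hM) hgen

end Main

end Literature.Probability.RandomPlanarGeometry

end
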